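import Mathlib
import Summits.CriticalPhenomena.PercolationContinuityZ3.Theorems.PercNearOneGluingNoHeavyLowerTailDiffHurwitzRouthChain
import Summits.CriticalPhenomena.PercolationContinuityZ3.Theorems.PercNearOneGluingNoHeavyLowerTailFallingMeshPos
import Summits.CriticalPhenomena.PercolationContinuityZ3.Theorems.PercNearOneGluingNoHeavyLowerTailDiffHurwitzRouth
import HarnessLib

/-!
# THEOREM R^sep (finite-difference Asner theorem): mesh > 1 ⟹ the difference–Hurwitz matrix is TN

Support file for the Sahi / Conjecture-P programme of route `PercNearOneGluingNoHeavy`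
(`--supports stmt-CriticalPhenomena-4575`, prover prim-l12-p5 gen 48; proof note
`prim-l12-p5/PROOF-DIFFERENCE-HURWITZ-g48.md` §2).  No definitions, no named facts, no sorries.

* `DiffHurwitz.routhChain_exists_of_mesh`: for `P = lc·∏_{i ≤ k}(X - α_i)` with `lc > 0`, `α_k < 0` and
  `α_i + 1 < α_{i+1}` (mesh `> 1`), the forward difference `ΔP = P(·+1) - P` is `lq·∏_{i<k}(X - γ_i)` with
  `lq > 0` and `α_i < γ_i < α_{i+1} - 1`, so `(P, ΔP)` satisfies the invariant J and the discrete Routh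
  chain exists (`DiffHurwitz.routhChain_exists`).
* `DiffHurwitz.diffHurwitz_tn` (**THEOREM R^sep**, strict form, step 1): for such `P` and `β ≥ 0` the
  difference–Hurwitz matrix `interleave(P(Θ), ΔP(Θ)Φ)` — rows `2n ↦ C(n,l)β^{n-l}(Δ^{n-l}P)(l)`,
  `2n+1 ↦ β·(ΔP(Θ))(n,l) + (ΔP(Θ))(n,l-1)` — is totally nonnegative (`DiffHurwitz.routh_tn`).
With THEOREM Λ (`FallingMesh.fallingMesh_roots`) this is CONJECTURE R for the equal-ratio family
(memo COROLLARY E), for strictly sub-neutral copies.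
-/

namespace Summit.CriticalPhenomena.PercolationContinuityZ3.Theorems

namespace DiffHurwitz

open Finset Polynomial FallingMesh fwdDiff

/-- **(P, ΔP) satisfies J when mesh(P) > 1**, hence the Routh chain of `(P, ΔP)` exists. -/
theorem routhChain_exists_of_mesh (k : ℕ) (lc : ℝ) (α : ℕ → ℝ) (hlc : 0 < lc) (hαneg : α k < 0)
    (hgap : ∀ i, i < k → α i + 1 < α (i + 1)) :
    ∃ (ps qs : ℕ → ℝ → ℝ) (cs cs' : ℕ → ℝ) (κ : ℝ), 0 < κ ∧ (∀ j, 0 ≤ cs j) ∧ (∀ j, 0 ≤ cs' j) ∧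
      (∀ x, ps 0 x = lc * ∏ i ∈ range (k + 1), (x - α i)) ∧
      (∀ x, qs 0 x = lc * ∏ i ∈ range (k + 1), (x + 1 - α i) - lc * ∏ i ∈ range (k + 1), (x - α i)) ∧
      (∀ j, j < k + 1 → ∀ x, ps j x = ps (j + 1) x + cs j * (x * qs j (x - 1))) ∧
      (∀ j, j < k + 1 → ∀ x, qs j x = qs (j + 1) x + cs' j * ps (j + 1) (x + 1)) ∧
      (∀ x, ps (k + 1) x = κ) ∧ (∀ x, qs (k + 1) x = 0) := by
  have hαmono : ∀ i j, i < j → j ≤ k → α i + 1 < α j := by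
    intro i j hij hjk
    induction j with
    | zero => exact absurd hij (by omega)
    | succ j ihj =>
      rcases Nat.lt_or_ge i j with h' | h'
      · linarith [ihj h' (by omega), hgap j (by omega)]
      · rw [show i = j by omega]; exact hgap j (by omega)
  have hαle : ∀ i j, i ≤ j → j ≤ k → α i ≤ α j := by
    intro i j hij hjk
    rcases Nat.lt_or_ge i j with h' | h'
    · linarith [hαmono i j h' hjk]
    · rw [show i = j by omega]
  obtain ⟨P, hP⟩ : ∃ P : ℝ[X], P = C lc * ∏ i ∈ range (k + 1), (X - C (α i)) := ⟨_, rfl⟩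
  obtain ⟨Ps, hPs⟩ : ∃ Ps : ℝ[X], Ps = C lc * ∏ i ∈ range (k + 1), (X - C (α i - 1)) := ⟨_, rfl⟩
  have hPs_ev : ∀ y, Ps.eval y = lc * ∏ i ∈ range (k + 1), (y + 1 - α i) := by
    intro y; rw [hPs, prodForm_eval]; congr 1; exact prod_congr rfl fun i _ => by ring
  obtain ⟨D, hD⟩ : ∃ D : ℝ[X], D = Ps - P := ⟨_, rfl⟩
  have hDev : ∀ y, D.eval y = lc * ∏ i ∈ range (k + 1), (y + 1 - α i) - lc * ∏ i ∈ range (k + 1), (y - α i) := by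
    intro y; rw [hD, eval_sub, hPs_ev, hP, prodForm_eval]
  -- signs: (-1)^(k-i) D(α_i) > 0 (i ≤ k), (-1)^(k-i-1) D(α_{i+1} - 1) > 0 (i < k)
  have hs1 : ∀ i, i < k + 1 → 0 < (-1 : ℝ) ^ (k - i) * D.eval (α i) := by
    intro i hi
    have hz : ∏ j ∈ range (k + 1), (α i - α j) = 0 := prod_eq_zero (mem_range.2 hi) (sub_self _)
    have hs := sign_prod (k + 1) (k - i) α (α i + 1) (by omega)
      (fun j hj => by linarith [hαle j i (by omega) (by omega)])
      (fun j hj hj' => by linarith [hαmono i j (by omega) (by omega)])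
    rw [hDev, hz, mul_zero, sub_zero, show (-1 : ℝ) ^ (k - i) * (lc * ∏ j ∈ range (k + 1), (α i + 1 - α j))
      = lc * ((-1 : ℝ) ^ (k - i) * ∏ j ∈ range (k + 1), (α i + 1 - α j)) by ring]
    exact mul_pos hlc hs
  have hs2 : ∀ i, i < k → 0 < (-1 : ℝ) ^ (k - i - 1) * D.eval (α (i + 1) - 1) := by
    intro i hi
    have hz : ∏ j ∈ range (k + 1), (α (i + 1) - 1 + 1 - α j) = 0 :=
      prod_eq_zero (i := i + 1) (mem_range.2 (by omega)) (by ring)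
    have hs := sign_prod (k + 1) (k - i) α (α (i + 1) - 1) (by omega)
      (fun j hj => by linarith [hαle j i (by omega) (by omega), hgap i hi])
      (fun j hj hj' => by linarith [hαle (i + 1) j (by omega) (by omega)])
    rw [hDev, hz, mul_zero, zero_sub, show (-1 : ℝ) ^ (k - i - 1) * -(lc * ∏ j ∈ range (k + 1), (α (i + 1) - 1 - α j))
      = lc * ((-1 : ℝ) ^ (k - i - 1) * (-1) * ∏ j ∈ range (k + 1), (α (i + 1) - 1 - α j)) by ring,
      show (-1 : ℝ) ^ (k - i - 1) * (-1) = (-1) ^ (k - i) by rw [← pow_succ, show k - i - 1 + 1 = k - i by omega]]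
    exact mul_pos hlc hs
  have hex : ∀ i, i < k → ∃ x, α i < x ∧ x < α (i + 1) - 1 ∧ D.eval x = 0 := by
    intro i hi
    apply exists_root_of_sign_change _ D.continuous _ _ (by linarith [hgap i hi])
    have h1 := hs1 i (by omega)
    have h2 := hs2 i hi
    rw [show (-1 : ℝ) ^ (k - i) = (-1) ^ (k - i - 1) * (-1) by
      rw [← pow_succ, show k - i - 1 + 1 = k - i by omega]] at h1
    exact mul_neg_of_signs _ _ _ h1 h2
  choose! γ hγ using hex
  have hγmono : ∀ i j, i < j → j < k → γ i < γ j := by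
    intro i j hij hjk
    linarith [(hγ i (by omega)).2.1, (hγ j hjk).1, hαle (i + 1) j (by omega) (by omega)]
  have hγtop : ∀ j, j < k → γ j < α k := fun j hj => by
    linarith [(hγ j hj).2.1, hαle (j + 1) k (by omega) le_rfl]
  obtain ⟨hPnd, hPlc⟩ := prodForm_natDegree lc (ne_of_gt hlc) α (k + 1)
  obtain ⟨hPsnd, hPslc⟩ := prodForm_natDegree lc (ne_of_gt hlc) (fun i => α i - 1) (k + 1)
  rw [← hP] at hPnd hPlc
  rw [← hPs] at hPsnd hPslc
  have hDdeg : D.degree ≤ (k : ℕ) := by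
    rw [hD]; exact degree_sub_le_of_cancel Ps P k hPsnd hPnd (by rw [hPslc, hPlc])
  have hDform := eq_prod_of_roots k D hDdeg γ hγmono (fun j hj => (hγ j hj).2.2) (α k) hγtop
  obtain ⟨lq, hlq⟩ : ∃ lq : ℝ, lq = D.eval (α k) / ∏ j ∈ range k, (α k - γ j) := ⟨_, rfl⟩
  rw [← hlq] at hDform
  have hlqpos : 0 < lq := by
    rw [hlq]
    refine div_pos ?_ (prod_pos fun j hj => by rw [mem_range] at hj; linarith [hγtop j hj])
    have := hs1 k (by omega); rwa [Nat.sub_self, pow_zero, one_mul] at this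
  obtain ⟨ps, qs, cs, cs', κ, hκ, hcs, hcs', hps0, hqs0, hA, hB, hpT, hqT⟩ :=
    routhChain_exists k lc lq α γ hlc hlqpos hαneg
      (fun i hi => ⟨by linarith [(hγ i hi).1], (hγ i hi).2.1⟩)
  refine ⟨ps, qs, cs, cs', κ, hκ, hcs, hcs', hps0, fun x => ?_, hA, hB, hpT, hqT⟩
  rw [hqs0, ← hDev, hDform, prodForm_eval]

/-- **THEOREM R^sep (finite-difference Asner theorem, strict form).**  Let `β ≥ 0`, let
`A_f(n,l) = [l ≤ n] C(n,l) β^{n-l} (Δ^{n-l} f)(l)` be the rows of `f(Θ)` (`Θ = βD + N̂`), and let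
`P(x) = lc·∏_{i ≤ k}(x - α_i)` with `lc > 0`, `α_k < 0`, `α_i + 1 < α_{i+1}`.  Then the difference–Hurwitz
matrix — rows `2n ↦ A_P(n,·)` and `2n+1 ↦ β A_{ΔP}(n,·) + A_{ΔP}(n,·-1)` (`= (ΔP(Θ)Φ)(n,·)`), `ΔP = P(·+1) - P`
— is totally nonnegative. -/
theorem diffHurwitz_tn (β : ℝ) (hβ : 0 ≤ β) (A : (ℝ → ℝ) → ℕ → ℕ → ℝ)
    (hAdef : ∀ f n l, A f n l =
      if l ≤ n then (n.choose l : ℝ) * β ^ (n - l) * (Δ_[(1 : ℝ)])^[n - l] f l else 0)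
    (k : ℕ) (lc : ℝ) (α : ℕ → ℝ) (hlc : 0 < lc) (hαneg : α k < 0)
    (hgap : ∀ i, i < k → α i + 1 < α (i + 1))
    {m : ℕ} (r s : Fin m → ℕ) (hr : StrictMono r) (hs : StrictMono s) :
    0 ≤ (Matrix.of fun i j =>
      if r i % 2 = 0 then A (fun x => lc * ∏ i ∈ range (k + 1), (x - α i)) (r i / 2) (s j)
      else β * A (fun x => lc * ∏ i ∈ range (k + 1), (x + 1 - α i) - lc * ∏ i ∈ range (k + 1), (x - α i))
          (r i / 2) (s j)
        + if 1 ≤ s j then A (fun x => lc * ∏ i ∈ range (k + 1), (x + 1 - α i)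
            - lc * ∏ i ∈ range (k + 1), (x - α i)) (r i / 2) (s j - 1) else 0).det := by
  obtain ⟨ps, qs, cs, cs', κ, hκ, hcs, hcs', hps0, hqs0, hA, hB, hpT, hqT⟩ :=
    routhChain_exists_of_mesh k lc α hlc hαneg hgap
  have e1 : (fun x => lc * ∏ i ∈ range (k + 1), (x - α i)) = ps 0 := funext fun x => (hps0 x).symm
  have e2 : (fun x => lc * ∏ i ∈ range (k + 1), (x + 1 - α i) - lc * ∏ i ∈ range (k + 1), (x - α i)) = qs 0 :=
    funext fun x => (hqs0 x).symm
  rw [e1, e2]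
  exact routh_tn β hβ A hAdef (k + 1) ps qs cs cs' κ hκ.le hcs hcs' hA hB hpT hqT r s hr hs


/-- **COROLLARY (THEOREM Λ + THEOREM R^sep): the difference–Hurwitz matrices of the falling-factorial
family are TN.**  For the polynomials `P_T^{(q)}` of the recursion
`C q · P (t+1) q = (C q + X) · P t (q+1) - C (1 - g t) · (X · (P t (q+1)).comp (X - 1))` (`q > 0`),
`P 0 q = 1` (`0 < g t < 1`; these are the band matrices `W = P(Θ₀)` of the equal-ratio copy systems, memo §3.1), and
every `q > 0`, `β ≥ 0`, the kernel `interleave(P(Θ), ΔP(Θ)Φ)` is totally nonnegative. -/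
theorem fallingMesh_diffHurwitz_tn (β : ℝ) (hβ : 0 ≤ β) (A : (ℝ → ℝ) → ℕ → ℕ → ℝ)
    (hAdef : ∀ f n l, A f n l =
      if l ≤ n then (n.choose l : ℝ) * β ^ (n - l) * (Δ_[(1 : ℝ)])^[n - l] f l else 0)
    (P : ℕ → ℝ → ℝ[X]) (g : ℕ → ℝ) (hg : ∀ t, 0 < g t ∧ g t < 1) (hP0 : ∀ q, P 0 q = 1)
    (hPs : ∀ t q, 0 < q → C q * P (t + 1) q =
      (C q + X) * P t (q + 1) - C (1 - g t) * (X * (P t (q + 1)).comp (X - C 1)))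
    (T : ℕ) (q : ℝ) (hq : 0 < q)
    {m : ℕ} (r s : Fin m → ℕ) (hr : StrictMono r) (hs : StrictMono s) :
    0 ≤ (Matrix.of fun i j =>
      if r i % 2 = 0 then A (fun x => (P T q).eval x) (r i / 2) (s j)
      else β * A (fun x => (P T q).eval (x + 1) - (P T q).eval x) (r i / 2) (s j)
        + if 1 ≤ s j then A (fun x => (P T q).eval (x + 1) - (P T q).eval x) (r i / 2) (s j - 1) else 0).det := by
  obtain ⟨lc, ρ, hlc, hρq, hρgap, hPT⟩ := fallingMesh_roots_pos P g hg hP0 hPs T q hq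
  rcases T with _ | k
  · -- T = 0: P = 1, ΔP = 0: the trivial chain of length 0
    have hP1 : P 0 q = 1 := hP0 q
    have e1 : (fun x => (P 0 q).eval x) = fun _ => (1 : ℝ) := funext fun x => by rw [hP1, eval_one]
    have e2 : (fun x => (P 0 q).eval (x + 1) - (P 0 q).eval x) = fun _ => (0 : ℝ) :=
      funext fun x => by rw [hP1, eval_one, eval_one, sub_self]
    rw [e1, e2]
    exact routh_tn β hβ A hAdef 0 (fun _ _ => 1) (fun _ _ => 0) (fun _ => 0) (fun _ => 0) 1 zero_le_one
      (fun _ => le_rfl) (fun _ => le_rfl) (fun _ h => absurd h (by omega)) (fun _ h => absurd h (by omega))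
      (fun _ => rfl) (fun _ => rfl) r s hr hs
  · have e1 : (fun x => (P (k + 1) q).eval x) = fun x => lc * ∏ i ∈ range (k + 1), (x - ρ i) :=
      funext fun x => by rw [hPT, prodForm_eval]
    have e2 : (fun x => (P (k + 1) q).eval (x + 1) - (P (k + 1) q).eval x)
        = fun x => lc * ∏ i ∈ range (k + 1), (x + 1 - ρ i) - lc * ∏ i ∈ range (k + 1), (x - ρ i) :=
      funext fun x => by rw [hPT, prodForm_eval, prodForm_eval]
    rw [e1, e2]
    exact diffHurwitz_tn β hβ A hAdef k lc ρ hlc (by linarith [hρq k (by omega)])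
      (fun i hi => hρgap i (by omega)) r s hr hs


/-- **The odd rows are the commutator rows.**  For any `f`: `β A_{Δf}(n,l) + A_{Δf}(n,l-1) = A_f(n+1,l) - A_f(n,l-1)`,
i.e. `Δf(Θ)Φ = [S, f(Θ)]`: the difference–Hurwitz matrix is `interleave(W, C)` with `W = f(Θ)` and
`C(n,l) = W(n+1,l) - W(n,l-1)` — the operator Hurwitz matrix `R(W)` of the memos. -/
theorem rowB_eq_comm (β : ℝ) (A : (ℝ → ℝ) → ℕ → ℕ → ℝ)
    (hAdef : ∀ f n l, A f n l =
      if l ≤ n then (n.choose l : ℝ) * β ^ (n - l) * (Δ_[(1 : ℝ)])^[n - l] f l else 0)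
    (f : ℝ → ℝ) (n l : ℕ) :
    β * A (fun x => f (x + 1) - f x) n l + (if 1 ≤ l then A (fun x => f (x + 1) - f x) n (l - 1) else 0)
      = A f (n + 1) l - (if 1 ≤ l then A f n (l - 1) else 0) := by
  have hlin : ∀ n' l', A (fun x => f (x + 1) - f x) n' l' = A (fun x => f (x + 1)) n' l' - A f n' l' := by
    intro n' l'
    have h1 := rowA_lin β A hAdef (fun x => f (x + 1)) f (-1) n' l'
    have e : (fun x => f (x + 1) - f x) = (fun x => f (x + 1) + (-1) * f x) := funext fun x => by ring
    rw [e, h1]; ring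
  have hsh := rowB_shift β A hAdef f n l
  rw [hlin, hlin]
  split_ifs with h
  · rw [if_pos h] at hsh; linarith
  · rw [if_neg h] at hsh; linarith

/-- **THEOREM R^sep, operator-Hurwitz form.**  Same as `diffHurwitz_tn` with the odd rows written as the
commutator rows `W(n+1,l) - W(n,l-1)` of `W = P(Θ)`. -/
theorem diffHurwitz_tn' (β : ℝ) (hβ : 0 ≤ β) (A : (ℝ → ℝ) → ℕ → ℕ → ℝ)
    (hAdef : ∀ f n l, A f n l =
      if l ≤ n then (n.choose l : ℝ) * β ^ (n - l) * (Δ_[(1 : ℝ)])^[n - l] f l else 0)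
    (k : ℕ) (lc : ℝ) (α : ℕ → ℝ) (hlc : 0 < lc) (hαneg : α k < 0)
    (hgap : ∀ i, i < k → α i + 1 < α (i + 1))
    {m : ℕ} (r s : Fin m → ℕ) (hr : StrictMono r) (hs : StrictMono s) :
    0 ≤ (Matrix.of fun i j =>
      if r i % 2 = 0 then A (fun x => lc * ∏ i ∈ range (k + 1), (x - α i)) (r i / 2) (s j)
      else A (fun x => lc * ∏ i ∈ range (k + 1), (x - α i)) (r i / 2 + 1) (s j)
        - if 1 ≤ s j then A (fun x => lc * ∏ i ∈ range (k + 1), (x - α i)) (r i / 2) (s j - 1) else 0).det := by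
  have key := diffHurwitz_tn β hβ A hAdef k lc α hlc hαneg hgap r s hr hs
  have heq : ∀ n l, A (fun x => lc * ∏ i ∈ range (k + 1), (x - α i)) (n + 1) l
      - (if 1 ≤ l then A (fun x => lc * ∏ i ∈ range (k + 1), (x - α i)) n (l - 1) else 0)
      = β * A (fun x => lc * ∏ i ∈ range (k + 1), (x + 1 - α i) - lc * ∏ i ∈ range (k + 1), (x - α i)) n l
        + (if 1 ≤ l then A (fun x => lc * ∏ i ∈ range (k + 1), (x + 1 - α i)
            - lc * ∏ i ∈ range (k + 1), (x - α i)) n (l - 1) else 0) := by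
    intro n l
    rw [← rowB_eq_comm β A hAdef (fun x => lc * ∏ i ∈ range (k + 1), (x - α i)) n l]
  have hM : (Matrix.of fun i j =>
      if r i % 2 = 0 then A (fun x => lc * ∏ i ∈ range (k + 1), (x - α i)) (r i / 2) (s j)
      else A (fun x => lc * ∏ i ∈ range (k + 1), (x - α i)) (r i / 2 + 1) (s j)
        - if 1 ≤ s j then A (fun x => lc * ∏ i ∈ range (k + 1), (x - α i)) (r i / 2) (s j - 1) else 0)
      = Matrix.of fun i j =>
      if r i % 2 = 0 then A (fun x => lc * ∏ i ∈ range (k + 1), (x - α i)) (r i / 2) (s j)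
      else β * A (fun x => lc * ∏ i ∈ range (k + 1), (x + 1 - α i) - lc * ∏ i ∈ range (k + 1), (x - α i))
          (r i / 2) (s j)
        + if 1 ≤ s j then A (fun x => lc * ∏ i ∈ range (k + 1), (x + 1 - α i)
            - lc * ∏ i ∈ range (k + 1), (x - α i)) (r i / 2) (s j - 1) else 0 := by
    ext i j
    simp only [Matrix.of_apply]
    by_cases h : r i % 2 = 0
    · simp only [if_pos h]
    · simp only [if_neg h]; exact heq _ _
  rw [hM]; exact key

end DiffHurwitz

end Summit.CriticalPhenomena.PercolationContinuityZ3.Theorems
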